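import Literature.Probability.LatticeModels.GlauberTwoBlockLogSobolevStrips
import Literature.Probability.LatticeModels.GlauberConditionalGradientBound
import Literature.Probability.LatticeModels.BoxSplitTwoBlockGap
import HarnessLib

/-!
# [Mar99] Theorem 4.6, the scale step (4.20)–(4.25) for a box, PROVED

Topic `Literature/Probability/LatticeModels`; cell `ym-ir`, seat lit-3 (census rows B2/B4).  Theorems only
(D-0026).  [Mar99] F. Martinelli, LNM 1717 (1999), Theorem 4.6, proof p0190 L18 – p0191 L27: the box
`Q = Π[a_i,b_i)` is covered, for each `n < N`, by `R_n^{top} = {y_j ≥ s_n}` and `R_n^{bot} = {y_j < s_n + δ}`,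
`s_n = c + n(δ + r)`; (4.20) (conditioning on `R_n^{bot}`), (4.21) ((3.33) + the log-Sobolev inequality of
`R_n^{top}` for `g_n = √(μ_{R_n^{bot}}(f²))`), Lemma 4.7 (the gradient bound for `g_n`, here the tree's
`integral_gradSq_sqrt_bavg_le`, fed by the boundary-gradient bound (4.28) on the volumes `R_n^{bot}` — an
explicit hypothesis `hGB` of this file, discharged on fat rectangles by Corollary 4.9) and the averaging
(4.23)–(4.25) over `n` (the tree's `logSobolevIneq_of_twoBlock_family_strips`, with the pairwise disjoint
strips `O_n = {s_n ≤ y_j < s_{n+1}}` carrying Lemma 4.7's overlap error).  Contents: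
* `Glauber.boxSplit_dominated` — (3.33) for the split box (`boxSplit_density_bound'`) in the two-sided form
  `μ_Q^τ(E) ≤ e μ_{Top}^τ(E)`, `μ_{Top}^τ(E) ≤ e μ_Q^τ(E)`, `e = (1 − κ/(1−κ))⁻¹`, for events `E` reading no spin
  of `Bot`;
* `Glauber.logSobolevIneq_box_of_halves` — **the step**: if all the parts `R_n^{top}`, `R_n^{bot}` satisfy a
  log-Sobolev inequality with constant `c_s` (all boundary conditions) and (4.28) holds on the `R_n^{bot}`
  with constants `(k, m')`, then `μ_Q^τ` satisfies one with constant
  `e² c_s ((1 + η)(1 + 1/N) + k₁/N)`, `η = k K₂ e^{−m'δ/2}`, `k₁ = k(1 + K₁)` (`K₁, K₂` the lattice sums of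
  Lemma 4.7), cf. (4.25) `c_s(2L) ≤ (1 + k/√L) c_s(L)` once `N ∼ √L`.
SIBLING-SETTING result (`±1` spins, range `r`); the Yang–Mills gap is not touched.
[cite: Martinelli1999, Theorem 4.6, proof, (4.20)–(4.25)]
-/

open MeasureTheory ProbabilityTheory Finset Filter

open scoped ENNReal NNReal

noncomputable section

namespace Literature.Probability.LatticeModels

namespace Glauber

variable {d : ℕ}

/-- `κ ↦ κ/(1−κ)` is monotone on `[0,1)`. [folklore] -/
private theorem div_one_sub_le_div_one_sub₃ {x y : ℝ} (hxy : x ≤ y) (hy : y < 1) :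
    x / (1 - x) ≤ y / (1 - y) := by
  rw [div_le_div_iff₀ (by linarith) (by linarith)]
  nlinarith

/-- A real-valued domination `μ(E) ≤ c ν(E)` of finite measures, in `ℝ≥0∞`. [folklore] -/
private theorem measure_le_coe_mul_of_real_le {Ω : Type*} [MeasurableSpace Ω] {μ ν : Measure Ω}
    [IsFiniteMeasure μ] [IsFiniteMeasure ν] {c : ℝ} (hc : 0 ≤ c) {E : Set Ω}
    (h : μ.real E ≤ c * ν.real E) : μ E ≤ (c.toNNReal : ℝ≥0∞) * ν E := by
  rw [← ofReal_measureReal (μ := μ) (s := E), ← ofReal_measureReal (μ := ν) (s := E),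
    show ((c.toNNReal : ℝ≥0) : ℝ≥0∞) = ENNReal.ofReal c from rfl, ← ENNReal.ofReal_mul hc]
  exact ENNReal.ofReal_le_ofReal h

/-- A lower bound on one coordinate difference bounds the sup-distance below. [folklore] -/
private theorem le_supDist_of_le_sub {x y : Site d} {i : Fin d} {n : ℕ} (h : (n : ℤ) ≤ x i - y i) :
    n ≤ supDist x y := by
  have h1 := natAbs_sub_le_supDist x y i
  have h2 : n ≤ (x i - y i).natAbs := by omega
  exact h2.trans h1

section Step

variable {r : ℕ} (U : FRPotential d ℤˣ r) (β : ℝ)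

set_option maxHeartbeats 1600000 in
/-- **(3.33) for the split box, two-sided form** ([Mar99] Theorem 4.6, proof, (4.21): «we apply (3.33)»): under
the hypotheses of `boxSplit_density_bound'` with the error uniformised through `|Q|` (`κ < ½`), for every event
`E` reading no spin of `Bot`, `μ_Q^τ(E) ≤ e μ_{Top}^τ(E)` and `μ_{Top}^τ(E) ≤ e μ_Q^τ(E)` with
`e = (1 − κ/(1−κ))⁻¹`. [cite: Martinelli1999, Theorem 4.6, proof, (4.21)] -/
theorem boxSplit_dominated {R : ℝ} (hR1 : 1 ≤ R)
    (hR : ∀ (Λ : Finset (Site d)) (y : Site d) (σ : Site d → ℤˣ),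
      R⁻¹ ≤ flipWeight U β Λ y σ ∧ flipWeight U β Λ y σ ≤ R)
    {a b : Site d} {j : Fin d} {s t : ℤ} (hs : a j ≤ s) (hst : s < t) (ht : t ≤ b j)
    {ρ : ℕ} (hρr : r ≤ ρ) (hρst : (ρ : ℤ) + r ≤ t - s) (hwide : ∀ i, i ≠ j → (ρ : ℤ) + 1 ≤ b i - a i)
    {l m : ℝ} (hm : 0 ≤ m) (hl : l ≤ (ρ : ℝ) - 2 * r)
    (hSMT : ∀ a' b' : Site d, (∀ i, (ρ : ℤ) + 1 - r ≤ b' i - a' i ∧ b' i - a' i ≤ 2 * ρ + 1) →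
      SMT (U.spec β) (Fintype.piFinset fun i => Finset.Ico ((a') i) ((b') i)) l m)
    {κ : ℝ} (hκdef : κ = (1 + R ^ 6 * (2 * r + 1 : ℝ) ^ d * (2 * r + 1 : ℝ) ^ d *
        ((Fintype.piFinset fun i => Finset.Ico ((a) i) ((b) i))).card *
        ((2 * (ρ + r) + 1) ^ d : ℕ) * Real.exp (-(m * ((ρ : ℝ) - 2 * r)))) ^
        ((Fintype.piFinset fun i => Finset.Ico ((a) i) ((b) i))).card - 1)
    (hκ : κ < 1 / 2) (τ : Site d → ℤˣ) {E : Set (Site d → ℤˣ)} (hE : MeasurableSet E)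
    (hEB : DependsOn (· ∈ E)
      ((↑(Fintype.piFinset fun i => Finset.Ico ((a) i) ((Function.update b j t) i)) : Set (Site d))ᶜ)) :
    U.spec β (Fintype.piFinset fun i => Finset.Ico ((a) i) ((b) i)) τ E ≤
        (((1 - κ / (1 - κ))⁻¹).toNNReal : ℝ≥0∞) *
          U.spec β (Fintype.piFinset fun i => Finset.Ico ((Function.update a j s) i) ((b) i)) τ E ∧
      U.spec β (Fintype.piFinset fun i => Finset.Ico ((Function.update a j s) i) ((b) i)) τ E ≤
        (((1 - κ / (1 - κ))⁻¹).toNNReal : ℝ≥0∞) *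
          U.spec β (Fintype.piFinset fun i => Finset.Ico ((a) i) ((b) i)) τ E := by
  classical
  have hγ := U.isSpecification_spec β
  set Top := (Fintype.piFinset fun i => Finset.Ico ((Function.update a j s) i) ((b) i)) with hTop
  set Bot := (Fintype.piFinset fun i => Finset.Ico ((a) i) ((Function.update b j t) i)) with hBot
  set Q := (Fintype.piFinset fun i => Finset.Ico ((a) i) ((b) i)) with hQ
  haveI := hγ.isProbability Q τ
  haveI := hγ.isProbability Top τ
  have hTQ : Top ⊆ Q := IcoBox_top_subset a b j s hs
  have hBQ : Bot ⊆ Q := IcoBox_bot_subset a b j t ht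
  -- the explicit error of this split is at most `κ`
  set κn := (1 + R ^ 6 * (2 * r + 1 : ℝ) ^ d * (2 * r + 1 : ℝ) ^ d *
      ((rOuterBoundary r (Top ∩ Bot)).filter (· ∈ Top)).card *
      ((2 * (ρ + r) + 1) ^ d : ℕ) * Real.exp (-(m * ((ρ : ℝ) - 2 * r)))) ^
      ((rOuterBoundary r Top).filter (· ∈ Bot)).card - 1 with hκn
  have hc1 : (((rOuterBoundary r (Top ∩ Bot)).filter (· ∈ Top)).card : ℝ) ≤ Q.card := by
    exact_mod_cast Finset.card_le_card fun z hz => hTQ (Finset.mem_filter.1 hz).2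
  have hc2 : ((rOuterBoundary r Top).filter (· ∈ Bot)).card ≤ Q.card :=
    Finset.card_le_card fun z hz => hBQ (Finset.mem_filter.1 hz).2
  have hκn0 : 0 ≤ κn := by
    rw [hκn, sub_nonneg]; exact one_le_pow₀ (le_add_of_nonneg_right (by positivity))
  have hκnκ : κn ≤ κ := by
    rw [hκn, hκdef]
    refine sub_le_sub_right ?_ 1
    set α : ℝ := R ^ 6 * (2 * r + 1 : ℝ) ^ d * (2 * r + 1 : ℝ) ^ d with hα
    set e : ℝ := ((2 * (ρ + r) + 1) ^ d : ℕ) * Real.exp (-(m * ((ρ : ℝ) - 2 * r))) with he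
    have hα0 : 0 ≤ α := by positivity
    have he0 : 0 ≤ e := by positivity
    have h0 : α * (((rOuterBoundary r (Top ∩ Bot)).filter (· ∈ Top)).card : ℝ) * e ≤ α * Q.card * e := by
      gcongr
    have h1 : (1 : ℝ) + α * ((rOuterBoundary r (Top ∩ Bot)).filter (· ∈ Top)).card *
        ((2 * (ρ + r) + 1) ^ d : ℕ) * Real.exp (-(m * ((ρ : ℝ) - 2 * r))) ≤
        1 + α * Q.card * ((2 * (ρ + r) + 1) ^ d : ℕ) * Real.exp (-(m * ((ρ : ℝ) - 2 * r))) := by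
      have e1 : α * ((rOuterBoundary r (Top ∩ Bot)).filter (· ∈ Top)).card *
          ((2 * (ρ + r) + 1) ^ d : ℕ) * Real.exp (-(m * ((ρ : ℝ) - 2 * r))) =
          α * (((rOuterBoundary r (Top ∩ Bot)).filter (· ∈ Top)).card : ℝ) * e := by rw [he]; ring
      have e2 : α * Q.card * ((2 * (ρ + r) + 1) ^ d : ℕ) * Real.exp (-(m * ((ρ : ℝ) - 2 * r))) =
          α * Q.card * e := by rw [he]; ring
      rw [e1, e2]; linarith
    calc (1 + α * ((rOuterBoundary r (Top ∩ Bot)).filter (· ∈ Top)).card *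
          ((2 * (ρ + r) + 1) ^ d : ℕ) * Real.exp (-(m * ((ρ : ℝ) - 2 * r)))) ^
          ((rOuterBoundary r Top).filter (· ∈ Bot)).card
        ≤ (1 + α * Q.card * ((2 * (ρ + r) + 1) ^ d : ℕ) * Real.exp (-(m * ((ρ : ℝ) - 2 * r)))) ^
          ((rOuterBoundary r Top).filter (· ∈ Bot)).card :=
          pow_le_pow_left₀ (by positivity) h1 _
      _ ≤ (1 + α * Q.card * ((2 * (ρ + r) + 1) ^ d : ℕ) * Real.exp (-(m * ((ρ : ℝ) - 2 * r)))) ^ Q.card :=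
          pow_le_pow_right₀ (le_add_of_nonneg_right (by positivity)) hc2
  have hκn1 : κn < 1 := by linarith
  have hκ0 : 0 ≤ κ := hκn0.trans hκnκ
  -- (3.33)
  have h33 : |(U.spec β Top τ).real E - (U.spec β Q τ).real E| ≤ κn / (1 - κn) * (U.spec β Q τ).real E :=
    boxSplit_density_bound' U β hR1 hR hs hst ht hρr hρst hwide hm hl hSMT hκn1 τ hE hEB
      (fun z hz hzB => hz (Finset.mem_coe.2 hzB))
  set ε := κ / (1 - κ) with hε
  have hεn : κn / (1 - κn) ≤ ε := div_one_sub_le_div_one_sub₃ hκnκ (by linarith)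
  have hε0 : 0 ≤ ε := div_nonneg hκ0 (by linarith)
  have hε1 : ε < 1 := by rw [hε, div_lt_one (by linarith)]; linarith
  have hQ0 : 0 ≤ (U.spec β Q τ).real E := measureReal_nonneg
  have hT0 : 0 ≤ (U.spec β Top τ).real E := measureReal_nonneg
  have h33' : |(U.spec β Top τ).real E - (U.spec β Q τ).real E| ≤ ε * (U.spec β Q τ).real E :=
    h33.trans (mul_le_mul_of_nonneg_right hεn hQ0)
  have hab := abs_le.1 h33'
  have hinv0 : 0 ≤ (1 - ε)⁻¹ := inv_nonneg.2 (by linarith)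
  have h1e : 0 < 1 - ε := by linarith
  have hinv1 : 1 + ε ≤ (1 - ε)⁻¹ := by
    rw [← one_div, le_div_iff₀ h1e]
    linarith [mul_nonneg hε0 hε0]
  constructor
  · refine measure_le_coe_mul_of_real_le hinv0 ?_
    rw [← div_eq_inv_mul, le_div_iff₀ h1e]
    linarith [hab.1]
  · refine measure_le_coe_mul_of_real_le hinv0 ?_
    calc (U.spec β Top τ).real E ≤ (1 + ε) * (U.spec β Q τ).real E := by linarith [hab.2]
      _ ≤ (1 - ε)⁻¹ * (U.spec β Q τ).real E := mul_le_mul_of_nonneg_right hinv1 hQ0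

set_option maxHeartbeats 4000000 in
/-- **[Mar99] Theorem 4.6, the scale step (4.20)–(4.25) for a box**: see the module docstring.  Parts
`R_n^{top} = Π[a,b) ∩ {y_j ≥ c + n(δ+r)}`, `R_n^{bot} = Π[a,b) ∩ {y_j < c + n(δ+r) + δ}`, `n < N`,
`c + N(δ+r) ≤ b_j`; two-block error `κ < ½` as in `poincareIneq_box_of_halves`; (4.28) on the `R_n^{bot}`
with constants `(k, m')`; log-Sobolev constant `c_s` for all parts and all boundary conditions.  Conclusion:
`c_s(μ_Q^τ) ≤ e² c_s ((1 + η)(1 + 1/N) + k₁/N)`, `e = (1 − κ/(1−κ))⁻¹`, `η = k K₂ e^{−m'δ/2}`,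
`k₁ = k (1 + K₁)`, `K₁ = (2(1 − e^{−m'/d})⁻¹)^d`, `K₂ = (2(1 − e^{−m'/(2d)})⁻¹)^d`.
[cite: Martinelli1999, Theorem 4.6, proof, (4.20)–(4.25)] -/
theorem logSobolevIneq_box_of_halves (hd : 0 < d) {R : ℝ} (hR1 : 1 ≤ R)
    (hR : ∀ (Λ : Finset (Site d)) (y : Site d) (σ : Site d → ℤˣ),
      R⁻¹ ≤ flipWeight U β Λ y σ ∧ flipWeight U β Λ y σ ≤ R)
    {a b : Site d} {j : Fin d} {c : ℤ} {δ N : ℕ} (hN : 0 < N) (hδ0 : 0 < δ) (hc : a j ≤ c)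
    (hend : c + N * (δ + r) ≤ b j)
    {ρ : ℕ} (hρr : r ≤ ρ) (hρδ : ρ + r ≤ δ) (hwide : ∀ i, i ≠ j → (ρ : ℤ) + 1 ≤ b i - a i)
    {l m : ℝ} (hm : 0 ≤ m) (hl : l ≤ (ρ : ℝ) - 2 * r)
    (hSMT : ∀ a' b' : Site d, (∀ i, (ρ : ℤ) + 1 - r ≤ b' i - a' i ∧ b' i - a' i ≤ 2 * ρ + 1) →
      SMT (U.spec β) (Fintype.piFinset fun i => Finset.Ico ((a') i) ((b') i)) l m)
    {κ : ℝ} (hκdef : κ = (1 + R ^ 6 * (2 * r + 1 : ℝ) ^ d * (2 * r + 1 : ℝ) ^ d *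
        ((Fintype.piFinset fun i => Finset.Ico ((a) i) ((b) i))).card *
        ((2 * (ρ + r) + 1) ^ d : ℕ) * Real.exp (-(m * ((ρ : ℝ) - 2 * r)))) ^
        ((Fintype.piFinset fun i => Finset.Ico ((a) i) ((b) i))).card - 1)
    (hκ : κ < 1 / 2) {k m' : ℝ} (hk : 0 ≤ k) (hm' : 0 < m')
    (hGB : ∀ n : ℕ, n < N → ∀ (σ : Site d → ℤˣ) (x : Site d),
      x ∉ (Fintype.piFinset fun i => Finset.Ico ((a) i) ((Function.update b j (c + n * (δ + r) + δ)) i)) →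
      ∀ f : (Site d → ℤˣ) → ℝ, Measurable f → ∀ C : ℝ, (∀ σ, |f σ| ≤ C) →
        (Real.sqrt (∫ ω, f ω ^ 2 ∂(U.spec β
              (Fintype.piFinset fun i => Finset.Ico ((a) i) ((Function.update b j (c + n * (δ + r) + δ)) i))
              (spinFlip x σ))) -
            Real.sqrt (∫ ω, f ω ^ 2 ∂(U.spec β
              (Fintype.piFinset fun i => Finset.Ico ((a) i) ((Function.update b j (c + n * (δ + r) + δ)) i))
              σ))) ^ 2 ≤
          k * (∫ ω, siteGrad x f ω ^ 2 ∂(U.spec β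
              (Fintype.piFinset fun i => Finset.Ico ((a) i) ((Function.update b j (c + n * (δ + r) + δ)) i)) σ) +
            ∑ y ∈ (Fintype.piFinset fun i => Finset.Ico ((a) i) ((Function.update b j (c + n * (δ + r) + δ)) i)),
              Real.exp (-(m' * (supDist x y : ℝ))) * ∫ ω, siteGrad y f ω ^ 2 ∂(U.spec β
                (Fintype.piFinset fun i => Finset.Ico ((a) i) ((Function.update b j (c + n * (δ + r) + δ)) i))
                σ)))
    {cs : ℝ} (hcs : 0 ≤ cs)
    (hTop : ∀ n : ℕ, n < N → ∀ φ : Site d → ℤˣ,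
      LogSobolevIneq (U.spec β (Fintype.piFinset fun i => Finset.Ico ((Function.update a j (c + n * (δ + r))) i) ((b) i)) φ)
        (Fintype.piFinset fun i => Finset.Ico ((Function.update a j (c + n * (δ + r))) i) ((b) i)) cs)
    (hBot : ∀ n : ℕ, n < N → ∀ φ : Site d → ℤˣ,
      LogSobolevIneq (U.spec β (Fintype.piFinset fun i => Finset.Ico ((a) i) ((Function.update b j (c + n * (δ + r) + δ)) i)) φ)
        (Fintype.piFinset fun i => Finset.Ico ((a) i) ((Function.update b j (c + n * (δ + r) + δ)) i)) cs)
    (τ : Site d → ℤˣ) :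
    LogSobolevIneq (U.spec β (Fintype.piFinset fun i => Finset.Ico ((a) i) ((b) i)) τ)
      (Fintype.piFinset fun i => Finset.Ico ((a) i) ((b) i))
      (((1 - κ / (1 - κ))⁻¹) ^ 2 * cs *
        ((1 + k * (2 * (1 - Real.exp (-(m' / 2 / d)))⁻¹) ^ d * Real.exp (-(m' / 2 * δ))) * (1 + 1 / N) +
          k * (1 + (2 * (1 - Real.exp (-(m' / d)))⁻¹) ^ d) / N)) := by
  classical
  have hγ := U.isSpecification_spec β
  set Q := (Fintype.piFinset fun i => Finset.Ico ((a) i) ((b) i)) with hQ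
  -- the family
  set sN : ℕ → ℤ := fun n => c + n * (δ + r) with hsN
  set A : ℕ → Finset (Site d) := fun n =>
    (Fintype.piFinset fun i => Finset.Ico ((Function.update a j (sN n)) i) ((b) i)) with hA
  set B : ℕ → Finset (Site d) := fun n =>
    (Fintype.piFinset fun i => Finset.Ico ((a) i) ((Function.update b j (sN n + δ)) i)) with hB
  set O : ℕ → Finset (Site d) := fun n =>
    (Fintype.piFinset fun i => Finset.Ico ((Function.update a j (sN n)) i) ((Function.update b j (sN n + δ + r)) i))
    with hO
  have hδ0' : (0 : ℤ) < δ := by exact_mod_cast hδ0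
  have hr0 : (0 : ℤ) ≤ r := by positivity
  have hs_le : ∀ n : ℕ, a j ≤ sN n := fun n => by
    simp only [hsN]; have : (0 : ℤ) ≤ (n : ℤ) * (δ + r) := by positivity
    linarith
  have hst : ∀ n : ℕ, sN n < sN n + δ := fun n => by linarith
  have hend' : ∀ n : ℕ, n < N → sN n + δ + r ≤ b j := fun n hn => by
    simp only [hsN]
    have h2 : ((n : ℤ) + 1) ≤ N := by exact_mod_cast hn
    have h3 : ((n : ℤ) + 1) * (δ + r) ≤ N * (δ + r) := mul_le_mul_of_nonneg_right h2 (by positivity)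
    linarith
  have ht_le : ∀ n : ℕ, n < N → sN n + δ ≤ b j := fun n hn => by linarith [hend' n hn]
  have hAV : ∀ n, n < N → A n ⊆ Q := fun n _ => IcoBox_top_subset a b j _ (hs_le n)
  have hBV : ∀ n, n < N → B n ⊆ Q := fun n hn => IcoBox_bot_subset a b j _ (ht_le n hn)
  have hcover : ∀ n, n < N → A n ∪ B n = Q := fun n hn =>
    IcoBox_top_union_bot a b j _ _ (hs_le n) (hst n).le (ht_le n hn)
  have hOmem : ∀ n (y : Site d), y ∈ O n ↔ (∀ i, i ≠ j → a i ≤ y i ∧ y i < b i) ∧ sN n ≤ y j ∧ y j < sN n + δ + r := by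
    intro n y
    rw [hO, mem_IcoBox]
    constructor
    · intro h
      refine ⟨fun i hi => ?_, ?_, ?_⟩
      · have := h i; rwa [Function.update_of_ne hi, Function.update_of_ne hi] at this
      · have := (h j).1; rwa [Function.update_self] at this
      · have := (h j).2; rwa [Function.update_self] at this
    · rintro ⟨h1, h2, h3⟩ i
      by_cases hi : i = j
      · subst hi; rw [Function.update_self, Function.update_self]; exact ⟨h2, h3⟩
      · rw [Function.update_of_ne hi, Function.update_of_ne hi]; exact h1 i hi
  have hOsub : ∀ n, n < N → A n ∩ B n ⊆ O n := by
    intro n hn y hy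
    rw [show A n ∩ B n = _ from IcoBox_top_inter_bot a b j _ _ (hs_le n) (ht_le n hn), mem_IcoBox] at hy
    rw [hOmem]
    refine ⟨fun i hi => ?_, ?_, ?_⟩
    · have := hy i; rwa [Function.update_of_ne hi, Function.update_of_ne hi] at this
    · have := (hy j).1; rwa [Function.update_self] at this
    · have := (hy j).2; rw [Function.update_self] at this; linarith
  have hOV : ∀ n, n < N → O n ⊆ Q := by
    intro n hn y hy
    rw [hOmem] at hy
    rw [hQ, mem_IcoBox]
    intro i
    by_cases hi : i = j
    · subst hi; exact ⟨(hs_le n).trans hy.2.1, lt_of_lt_of_le hy.2.2 (hend' n hn)⟩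
    · exact hy.1 i hi
  have hdisj : ∀ n n', n < N → n' < N → n ≠ n' → Disjoint (O n) (O n') := by
    intro n n' _ _ hne
    rw [Finset.disjoint_left]
    intro y hy hy'
    rw [hOmem] at hy hy'
    have key : ∀ p q : ℕ, p < q → sN p + δ + r ≤ sN q := by
      intro p q hpq
      simp only [hsN]
      have h2 : ((p : ℤ) + 1) ≤ q := by exact_mod_cast hpq
      have h3 : ((p : ℤ) + 1) * (δ + r) ≤ q * (δ + r) := mul_le_mul_of_nonneg_right h2 (by positivity)
      linarith
    rcases Nat.lt_or_gt_of_ne hne with hlt | hlt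
    · linarith [key n n' hlt, hy.2.2, hy'.2.1]
    · linarith [key n' n hlt, hy'.2.2, hy.2.1]
  -- the two-sided domination (4.21)
  have hρst : ∀ n : ℕ, (ρ : ℤ) + r ≤ sN n + δ - sN n := fun n => by
    have : ((ρ + r : ℕ) : ℤ) ≤ δ := by exact_mod_cast hρδ
    push_cast at this; linarith
  set ε := κ / (1 - κ) with hε
  have hκ0 : 0 ≤ κ := by
    rw [hκdef, sub_nonneg]
    exact one_le_pow₀ (le_add_of_nonneg_right (by positivity))
  have hε0 : 0 ≤ ε := div_nonneg hκ0 (by linarith)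
  have hε1 : ε < 1 := by rw [hε, div_lt_one (by linarith)]; linarith
  have hinv0 : 0 ≤ (1 - ε)⁻¹ := inv_nonneg.2 (by linarith)
  set e : ℝ≥0 := ((1 - ε)⁻¹).toNNReal with he
  have he' : (e : ℝ) = (1 - ε)⁻¹ := Real.coe_toNNReal _ hinv0
  have hdom : ∀ n, n < N → ∀ E : Set (Site d → ℤˣ), MeasurableSet E →
      DependsOn (· ∈ E) ((↑(B n) : Set (Site d))ᶜ) →
      U.spec β Q τ E ≤ e * U.spec β (A n) τ E ∧ U.spec β (A n) τ E ≤ e * U.spec β Q τ E := by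
    intro n hn E hEm hEB
    exact boxSplit_dominated U β hR1 hR (hs_le n) (hst n) (ht_le n hn) hρr (hρst n) hwide hm hl hSMT hκdef hκ τ
      hEm hEB
  -- Lemma 4.7 on each part
  set K₁ : ℝ := (2 * (1 - Real.exp (-(m' / d)))⁻¹) ^ d with hK₁
  set K₂ : ℝ := (2 * (1 - Real.exp (-(m' / 2 / d)))⁻¹) ^ d with hK₂
  have hdpos : (0 : ℝ) < d := by exact_mod_cast hd
  have hK₁0 : 0 ≤ K₁ := pow_nonneg (mul_nonneg zero_le_two (inv_nonneg.2 (sub_nonneg.2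
    (Real.exp_le_one_iff.2 (by rw [neg_nonpos]; positivity))))) d
  have hK₂0 : 0 ≤ K₂ := pow_nonneg (mul_nonneg zero_le_two (inv_nonneg.2 (sub_nonneg.2
    (Real.exp_le_one_iff.2 (by rw [neg_nonpos]; positivity))))) d
  set k₁ : ℝ := k * (1 + K₁) with hk₁
  set η : ℝ := k * K₂ * Real.exp (-(m' / 2 * (δ : ℕ))) with hη
  have hk₁0 : 0 ≤ k₁ := by positivity
  have hη0 : 0 ≤ η := by positivity
  have h47 : ∀ n, n < N → ∀ f : (Site d → ℤˣ) → ℝ, Measurable f → (∃ C : ℝ, ∀ σ, |f σ| ≤ C) →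
      (∀ σ, 0 < f σ) →
      ∫ σ, gradSq (A n) (fun ω => Real.sqrt (bavg (U.spec β) (B n) (fun ω' => f ω' ^ 2) ω)) σ ∂(U.spec β Q τ) ≤
        ∫ σ, gradSq (A n) f σ ∂(U.spec β Q τ) + k₁ * ∫ σ, gradSq (O n) f σ ∂(U.spec β Q τ) +
          η * ∫ σ, gradSq (B n) f σ ∂(U.spec β Q τ) := by
    intro n hn f hf hbdd _
    obtain ⟨C, hC⟩ := hbdd
    have h1 : ∀ x ∈ A n, x ∉ B n → x ∉ O n → ∀ z ∈ B n, r < supDist x z := by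
      intro x hxA hxB hxO z hz
      have hxj : sN n + δ + r ≤ x j := le_of_not_mem_bot (Function.update a j (sN n)) b j (sN n + δ + r) hxA hxO
      have hzj : z j < sN n + δ := by
        have := (mem_IcoBox.1 hz j).2; rwa [Function.update_self] at this
      have h2 : ((r + 1 : ℕ) : ℤ) ≤ x j - z j := by push_cast; linarith
      have := le_supDist_of_le_sub h2
      omega
    have h2 : ∀ y ∈ B n, y ∉ O n → ∀ x ∈ A n, x ∉ B n → x ∈ O n → δ ≤ supDist x y := by
      intro y hyB hyO x hxA hxB _
      have hyB' : y ∈ (Fintype.piFinset fun i => Finset.Ico ((a) i) ((Function.update b j (sN n + δ + r)) i)) := by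
        rw [mem_IcoBox] at hyB ⊢
        intro i
        by_cases hi : i = j
        · subst hi
          have := hyB i; rw [Function.update_self] at this ⊢; exact ⟨this.1, by linarith [this.2]⟩
        · have := hyB i; rw [Function.update_of_ne hi] at this ⊢; exact this
      have hyj : y j < sN n := lt_of_not_mem_top a (Function.update b j (sN n + δ + r)) j (sN n) hyB' hyO
      have hxj : sN n + δ ≤ x j := le_of_not_mem_bot a b j (sN n + δ) (hAV n hn hxA) hxB
      have h3 : ((δ : ℕ) : ℤ) ≤ x j - y j := by linarith
      exact le_supDist_of_le_sub h3
    have h := integral_gradSq_sqrt_bavg_le U β hd (V := Q) (A := A n) (B := B n) (O := O n) (hBV n hn) τ hk hm'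
      (hGB n hn) h1 (w₀ := δ) h2 hf hC
    rw [hk₁, hη, hK₁, hK₂]
    exact h
  have key := logSobolevIneq_of_twoBlock_family_strips hγ τ hN A B O hBV hcover hOsub hOV hdisj hcs hcs
    (fun n hn σ => hBot n hn σ) (fun n hn => hTop n hn τ) hdom hk₁0 hη0 h47
  refine key.mono ?_
  rw [he']
  -- `max (cs + e² cs η, e² cs) (1 + 1/N) + e² cs k₁ / N ≤ e² cs ((1 + η)(1 + 1/N) + k₁/N)`
  set E2 : ℝ := ((1 - ε)⁻¹) ^ 2 with hE2
  have hE21 : 1 ≤ E2 := by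
    rw [hE2]; refine one_le_pow₀ ?_
    rw [le_inv_comm₀ one_pos (by linarith), inv_one]; linarith
  have hN0 : (0 : ℝ) < N := by exact_mod_cast hN
  have hcsE : cs ≤ E2 * cs := le_mul_of_one_le_left hcs hE21
  have hmax : max (cs + E2 * cs * η) (E2 * cs) ≤ E2 * cs * (1 + η) := by
    have h0 : 0 ≤ E2 * cs * η := mul_nonneg (mul_nonneg (zero_le_one.trans hE21) hcs) hη0
    refine max_le ?_ ?_
    · linarith
    · linarith
  have h1N : 0 ≤ 1 + 1 / (N : ℝ) := by positivity
  calc max (cs + E2 * cs * η) (E2 * cs) * (1 + 1 / (N : ℝ)) + E2 * cs * k₁ / N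
      ≤ E2 * cs * (1 + η) * (1 + 1 / (N : ℝ)) + E2 * cs * k₁ / N :=
        add_le_add (mul_le_mul_of_nonneg_right hmax h1N) le_rfl
    _ = E2 * cs * ((1 + η) * (1 + 1 / (N : ℝ)) + k₁ / N) := by ring

end Step

end Glauber

end Literature.Probability.LatticeModels

end
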